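import Literature.AlgebraicGeometry.ShimuraVarieties.KudlaRapoportYang2006.Ch3CyclesShimuraCurvesI
import Literature.NumberTheory.Automorphic.QuaternionAlgebraAdelicNormSqProofs
import HarnessLib

/-!
# [KudlaRapoportYang2006, §3.2 (p. 47)] «`V_ℝ` has signature `(1, 2)`» — DISCHARGED: `KRY2006_3_2_signature_holds`

Kernel-lane companion of the statement carpet ★
`Literature/AlgebraicGeometry/ShimuraVarieties/KudlaRapoportYang2006/Ch3CyclesShimuraCurvesI.lean` (squad TKR, seat TKR-t05):
its named fact ★ `KRY2006_3_2_signature` is PROVED here.  THEOREMS ONLY (no definition, no named fact, no `sorry`, no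
instance, no notation); cell hodgecm-mathlib, seat B-typ02 (g33); net debt −1.

S. Kudla, M. Rapoport, T. Yang, *Modular Forms and Special Cycles on Shimura Curves*, Annals of Math. Studies 161 (2006), Ch. 3
§3.2 (held `book:kudla2006-modular-forms-special-cycles-shimura-curves`, chunk p0049 L15).  THE PRINT (p. 47): «Since `B` is
indefinite, i.e., `B ⊗_ℚ ℝ ≃ M₂(ℝ)`, the quadratic space `V_ℝ` has signature `(1, 2)`.»  The carpet's fact: given an
`ℝ`-algebra isomorphism `B_ℝ = ℝ ⊗_ℚ B ≃ M₂(ℝ)` there are three `ℝ`-linearly independent, pairwise orthogonal (for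
`(x, y) = trd(x̄ y)`) trace-zero elements of `B_ℝ` whose reduced norms have signs `+, -, -`.

THE PROOF: in `M₂(ℝ)` the reduced trace is the trace and the reduced norm is the determinant (Vignéras I §1 p. 3; the tree's
★ `leftMulTrace_matrix_fin_two`, ★ `matrix_mul_trace_sub_self`, ★ `reducedNorm_eq_of_mul_standardInvolution_eq`), and both are
transported along the given isomorphism (★ `reducedTrace_algEquiv`, ★ `standardInvolution_algEquiv`); the witnesses are the
pull-backs of `(0 1; -1 0)` (`det = 1`), `(1 0; 0 -1)` and `(0 1; 1 0)` (`det = -1`), which are trace-zero, pairwise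
trace-orthogonal and linearly independent by inspection of entries (the model computation for `(a, b)_ℚ` is the tree's
★ `kryForm_signature_one_two`).  The hypothesis `IsQuaternionAlgebra ℚ B` of the fact is not needed and simply carried.
HONEST LABEL: HC_CM is proved only modulo the 7 printed citations (2 remaining: hLiu418, h413) until rung 0 closes; this file is
off that cone, adds no citation debt (0 facts, 0 sorry) and discharges 1 named fact of ★ `Ch3CyclesShimuraCurvesI`.

## References
* [KudlaRapoportYang2006] S. Kudla, M. Rapoport, T. Yang, Modular Forms and Special Cycles on Shimura Curves, Ann. of Math. Stud.
  161, Princeton 2006, Ch. 3 §3.2, p. 47.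
* [VignerasLNM800] M.-F. Vignéras, Arithmétique des algèbres de quaternions, LNM 800 (1980), Ch. I §1 p. 3 (`M(2, K)`: reduced
  trace = trace, reduced norm = determinant).
-/

noncomputable section

namespace Literature.AlgebraicGeometry.ShimuraVarieties.KudlaRapoportYang2006.Ch3CyclesShimuraCurvesI

open Literature.NumberTheory.Automorphic

universe u

/-! ## The split model `M₂(K)`: reduced trace = trace, reduced norm = determinant -/

section MatrixModel

variable {K : Type*} [Field K] [CharZero K]

/-- In `M₂(K)` the reduced trace `½·Tr(L_x)` is the matrix trace. [cite: VignerasLNM800, Ch. I §1 p. 3] -/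
theorem reducedTrace_matrix_fin_two (x : Matrix (Fin 2) (Fin 2) K) :
    reducedTrace K (Matrix (Fin 2) (Fin 2) K) x = x.trace := by
  rw [reducedTrace, LinearMap.smul_apply, leftMulTrace_matrix_fin_two, Matrix.trace_fin_two, smul_eq_mul,
    inv_mul_cancel_left₀ (two_ne_zero' K)]

/-- In `M₂(K)` the standard involution is `x ↦ tr(x)·1 - x` (the adjugate). [cite: VignerasLNM800, Ch. I §1 p. 3] -/
theorem standardInvolution_matrix_fin_two (x : Matrix (Fin 2) (Fin 2) K) :
    standardInvolution K (Matrix (Fin 2) (Fin 2) K) x = algebraMap K _ x.trace - x := by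
  rw [standardInvolution, reducedTrace_matrix_fin_two]

/-- In `M₂(K)` the reduced norm `¼·Tr(L_{x x̄})` is the determinant. [cite: VignerasLNM800, Ch. I §1 p. 3] -/
theorem reducedNorm_matrix_fin_two (x : Matrix (Fin 2) (Fin 2) K) :
    reducedNorm K (Matrix (Fin 2) (Fin 2) K) x = x.det := by
  refine reducedNorm_eq_of_mul_standardInvolution_eq (by simp [Module.finrank_matrix]) ?_
  rw [standardInvolution_matrix_fin_two, matrix_mul_trace_sub_self]

end MatrixModel

/-! ## The three witnesses in `M₂(ℝ)`: `(0 1; -1 0)`, `(1 0; 0 -1)`, `(0 1; 1 0)` -/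

/-- The witnesses are trace-zero. [folklore] -/
private theorem sigWitness_trace (i : Fin 3) :
    ((![!![0, 1; -1, 0], !![1, 0; 0, -1], !![0, 1; 1, 0]] : Fin 3 → Matrix (Fin 2) (Fin 2) ℝ) i).trace = 0 := by
  fin_cases i <;> simp [Matrix.trace_fin_two]

/-- The witnesses are pairwise orthogonal for `(x, y) = tr((tr(x) - x)·y)`. [folklore] -/
private theorem sigWitness_orthogonal (i j : Fin 3) (hij : i ≠ j) :
    ((algebraMap ℝ (Matrix (Fin 2) (Fin 2) ℝ) ((![!![0, 1; -1, 0], !![1, 0; 0, -1], !![0, 1; 1, 0]] : Fin 3 → Matrix (Fin 2) (Fin 2) ℝ) i).trace -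
        (![!![0, 1; -1, 0], !![1, 0; 0, -1], !![0, 1; 1, 0]] : Fin 3 → Matrix (Fin 2) (Fin 2) ℝ) i) *
      (![!![0, 1; -1, 0], !![1, 0; 0, -1], !![0, 1; 1, 0]] : Fin 3 → Matrix (Fin 2) (Fin 2) ℝ) j).trace = 0 := by
  fin_cases i <;> fin_cases j <;> first
    | exact absurd rfl hij
    | simp [Matrix.trace_fin_two]

/-- The witnesses are `ℝ`-linearly independent (inspect the entries `(0,0)`, `(0,1)`, `(1,0)`). [folklore] -/
private theorem sigWitness_linearIndependent :
    LinearIndependent ℝ (![!![0, 1; -1, 0], !![1, 0; 0, -1], !![0, 1; 1, 0]] : Fin 3 → Matrix (Fin 2) (Fin 2) ℝ) := by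
  rw [Fintype.linearIndependent_iff]
  intro c hc i
  have h00 := congr_fun (congr_fun hc 0) 0
  have h01 := congr_fun (congr_fun hc 0) 1
  have h10 := congr_fun (congr_fun hc 1) 0
  simp [Fin.sum_univ_three, Matrix.add_apply] at h00 h01 h10
  fin_cases i
  · change c 0 = 0; linarith
  · exact h00
  · change c 2 = 0; linarith

/-! ## The discharge -/

variable (B : Type u) [Ring B] [Algebra ℚ B]

/-- **[KRY2006, §3.2 p. 47] — DISCHARGED**: «Since `B` is indefinite, i.e., `B ⊗_ℚ ℝ ≃ M₂(ℝ)`, the quadratic space `V_ℝ` has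
signature `(1, 2)`»: three `ℝ`-linearly independent, pairwise orthogonal trace-zero elements of `B_ℝ` with reduced norms of
signs `+, -, -`. [cite: KudlaRapoportYang2006, §3.2 (p. 47)] -/
theorem KRY2006_3_2_signature_holds : KRY2006_3_2_signature B := by
  intro _ hind
  obtain ⟨e⟩ := hind
  refine ⟨fun i => e.symm ((![!![0, 1; -1, 0], !![1, 0; 0, -1], !![0, 1; 1, 0]] : Fin 3 → Matrix (Fin 2) (Fin 2) ℝ) i),
    fun i => ?_, ?_, fun i j hij => ?_, ?_, ?_, ?_⟩
  · rw [reducedTrace_algEquiv, reducedTrace_matrix_fin_two, sigWitness_trace]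
  · exact sigWitness_linearIndependent.map' e.symm.toLinearEquiv.toLinearMap e.symm.toLinearEquiv.ker
  · rw [standardInvolution_algEquiv, ← map_mul, reducedTrace_algEquiv, reducedTrace_matrix_fin_two,
      standardInvolution_matrix_fin_two, sigWitness_orthogonal i j hij]
  · rw [reducedNorm_algEquiv, reducedNorm_matrix_fin_two]
    simp [Matrix.det_fin_two_of]
  · rw [reducedNorm_algEquiv, reducedNorm_matrix_fin_two]
    simp [Matrix.det_fin_two_of]
  · rw [reducedNorm_algEquiv, reducedNorm_matrix_fin_two]
    simp [Matrix.det_fin_two_of]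

end Literature.AlgebraicGeometry.ShimuraVarieties.KudlaRapoportYang2006.Ch3CyclesShimuraCurvesI

end
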